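import Summits.ABC.IUTFork.Thm311LogKummer
import Summits.ABC.IUTFork.Thm311RealLattice
import HarnessLib

/-!
# [IUTchIII] Cor. 3.12, TEAM B row B-3: (Ind3) "from above", real — the upper-semi-compatibility
# containments of Thm 3.11 (ii) from componentwise containments in the shells

Record-only file (D-0012) of the abc-iut cell (Cor. 3.12 strategy TEAM B «estimate / log-Kummer» of
HUMAN RULING D-0067 (3), row B-3 of `HOME/plan/C312-TEAMS.md`, seat abc-iut-c312-12 = B2; the arch
clause input landed separately as `VerticallyCoricLGPArch` p411153, the nonarch packet-level clause as
`VerticallyCoricLGPPackets`); TAKES NO SIDE. [IUTchIII] Thm. 3.11 (ii) (Ind3) (kurims p. 156; Prop. 3.5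
(ii) (a), (b) pp. 104–105) is typed by abc-iut-c312-1 as `Column.Ind3 C D` (`Thm311LogKummer`): the
transported unit-group images `unitImage m m'` all lie in the ONE integral structure
`I(^{S^±_{j+1}};^{n,∘}D⊢_{v_ℚ})` (`D.shellPk`), and at archimedean `v_ℚ` likewise through the radius-`π`
balls (`ballImage`) — "upper semi-compatible": upper bounds only. Step (x) of the proof of Cor. 3.12
converts exactly these containments "into an inequality from above" (TEAM A row A-1 consumes them as
`LogvolCoarse.unitImage_logvol_le_shellPk`, p411096).

This file proves the containments COMPONENTWISE-TO-PACKET, for every log-shell signature: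

* `LogShells.tprodImages` — the packet subset cut out by a family of per-place component sets: all pure
  tensors whose every component lies in the given sets (the shape of the printed images "via the tensor
  product, over `|t|`, of the [relevant] Kummer isomorphisms", Prop. 3.5 (ii) (a) (1), (2));
  `tprodImages_mono` (monotone), `tprodImages_subset_shellPk` (components in the shell subgroups ⟹ the
  image lies in the packet integral structure `L.shellPk` — the generating pure tensors of
  abc-iut-c312-5's `shellTensors`).
* `Column.ind3_of_componentwise` — **(Ind3) HOLDS** for any column whose `unitImage`/`ballImage` are
  `tprodImages` of per-place data with: unit components in the shell subgroup (nonarch, all iterates;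
  arch, the un-iterated Kummer images), ball components in the shell subgroup (arch), and iterate
  components inside the ball components (arch, `m' ≥ 1`) — given `L.shellPk ⊆ D.shellPk` (the instance's
  integral structure contains the defined one; abc-iut-c312-5's real `MRData` instances take equality).
* `Column.ind3_of_componentwise_logShellsDH` — the Dupuy–Hilado instance (`Real.logShellsDH`, LogvLaw):
  with the unit components pinned to the HONEST per-place unit sets (`Real.unitsSet`: at a finite place
  the units `O_v^× = {x ≠ 0 | x, x⁻¹ ∈ O_v}` of the valuation subring; at an archimedean place
  `{‖a‖ = 1}`) and the ball components pinned to the shells, the containments of the un-iterated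
  components are PROVED (`Real.unitsSet_subset_shell_of_law`: `O_v^× ⊆ O_v ⊆ I_v` under the law, the
  printed "(b^non)"; `‖a‖ = 1 ≤ π` at arch); only the ITERATE components' containments remain as named
  hypotheses — their discharge at the analytic `p`-adic logarithm is abc-iut-L6-t3's
  `iterate_image_subset_logShell` (Rmk. 1.2.2 (iii)) and, at arch, the chosen bounded witnesses of
  `VerticallyCoricLGPArch.prop35ii_b_arcExp` (p411153).

Sources read on the page: [IUTchIII] pp. 104–105 (Prop. 3.5 (ii) (a), (b)), p. 156 (Thm. 3.11 (ii)
(Ind3)), pp. 180–181 (Step (x) "converting the indeterminacy (Ind3) into an inequality from above");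
Dupuy–Hilado §4 intro. [claim: Mochizuki2012, status: disputed] [cite: DupuyHilado2025, §4]
Deliberately NOT here: the log-volume consequences (rows B-2/B-4, landed), Prop. 3.5 (ii) (c) (row
B-1), the analytic-logarithm discharge of the iterate hypotheses (L5-t5/L6-t3 seam, named above), any
judgement on Cor. 3.12.
-/

noncomputable section

open Set

namespace Summit.ABC

namespace IUTFork

namespace Thm311

variable {T : ThetaIndex}

/-! ## 1. Packet subsets from per-place component sets -/

namespace LogShells

variable (L : LogShells T)

/-- The packet subset cut out by per-place component sets `S_v`: all pure tensors
`⊗_{i ∈ S^±_{j+1}} (x_{i,v})_v` with every component `x_{i,v} ∈ S_v` — the shape of the printed images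
of Prop. 3.5 (ii) (a) (1), (2) ("via the tensor product, over `|t|`, of the [relevant] Kummer
isomorphisms", resp. their pre-composites with log-link iterates) and (b).
[claim: Mochizuki2012, status: disputed] -/
def tprodImages (j : T.Label) (vQ : T.VQ) (S : ∀ v : T.Fibre vQ, Set (L.carrier v.1)) :
    Set (L.Packet j vQ) :=
  {t | ∃ x : T.Caps j → L.Packet1 vQ, (∀ i (v : T.Fibre vQ), x i v ∈ S v) ∧ t = L.tprod j vQ x}

/-- `tprodImages` is monotone in the component sets. [folklore] -/
theorem tprodImages_mono {j : T.Label} {vQ : T.VQ} {S S' : ∀ v : T.Fibre vQ, Set (L.carrier v.1)}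
    (h : ∀ v, S v ⊆ S' v) : L.tprodImages j vQ S ⊆ L.tprodImages j vQ S' := by
  rintro t ⟨x, hx, rfl⟩
  exact ⟨x, fun i v => h v (hx i v), rfl⟩

/-- **Components in the shell subgroups ⟹ the image lies in the packet integral structure**
`I(^{S^±_{j+1}};D⊢_{v_ℚ}) = L.shellPk` ([IUTchIII] Prop. 3.2 (ii)): such pure tensors are exactly the
generating `shellTensors` of abc-iut-c312-5's closure. [claim: Mochizuki2012, status: disputed] -/
theorem tprodImages_subset_shellPk {j : T.Label} {vQ : T.VQ}
    {S : ∀ v : T.Fibre vQ, Set (L.carrier v.1)} (h : ∀ v, S v ⊆ L.shellSubgroup v.1) :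
    L.tprodImages j vQ S ⊆ (L.shellPk j vQ : Set (L.Packet j vQ)) := by
  rintro t ⟨x, hx, rfl⟩
  rw [shellPk_eq_closure]
  exact AddSubgroup.subset_closure ⟨x, fun i v => h v (hx i v), rfl⟩

end LogShells

/-! ## 2. (Ind3) from componentwise containments -/

namespace Column

variable {L : LogShells T} (C : Column L) (D : MRData L)

/-- **[IUTchIII] Thm. 3.11 (ii) (Ind3) (kurims p. 156), componentwise form — `Ind3` HOLDS** for any
column whose transported unit-group and ball images are `tprodImages` of per-place component data
`U m m'` / `B m` with: (nonarch `v_ℚ`) every unit component, of every `m` and every iterate, in the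
shell subgroup; (arch `v_ℚ`) the un-iterated unit components and the ball components in the shell
subgroup, and the iterate components inside the ball components — given that the instance's integral
structure `D.shellPk` contains the defined `L.shellPk`. "The log-shell acts as an upper-bound that
simultaneously contains their images" — upper bounds only, no equality anywhere.
[claim: Mochizuki2012, status: disputed] -/
theorem ind3_of_componentwise
    (hpk : ∀ (j : T.Label) (vQ : T.VQ), (L.shellPk j vQ : Set (L.Packet j vQ)) ⊆ D.shellPk j vQ)
    (U : ℤ → ℕ → ∀ (vQ : T.VQ), ∀ v : T.Fibre vQ, Set (L.carrier v.1))
    (B : ℤ → ∀ (vQ : T.VQ), ∀ v : T.Fibre vQ, Set (L.carrier v.1))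
    (hUnon : ∀ (m : ℤ) (m' : ℕ) (vQ : T.VQ), T.IsNon vQ → ∀ v : T.Fibre vQ,
      U m m' vQ v ⊆ L.shellSubgroup v.1)
    (hUarc : ∀ (m : ℤ) (vQ : T.VQ), ¬ T.IsNon vQ → ∀ v : T.Fibre vQ,
      U m 0 vQ v ⊆ L.shellSubgroup v.1)
    (hBarc : ∀ (m : ℤ) (vQ : T.VQ), ¬ T.IsNon vQ → ∀ v : T.Fibre vQ,
      B m vQ v ⊆ L.shellSubgroup v.1)
    (hUB : ∀ (m : ℤ) (m' : ℕ), 1 ≤ m' → ∀ (vQ : T.VQ), ¬ T.IsNon vQ → ∀ v : T.Fibre vQ,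
      U (m - m') m' vQ v ⊆ B m vQ v)
    (hunit : ∀ (m : ℤ) (m' : ℕ) (j : T.Label) (vQ : T.VQ),
      C.unitImage m m' j vQ = L.tprodImages j vQ (U m m' vQ))
    (hball : ∀ (m : ℤ) (j : T.Label) (vQ : T.VQ),
      C.ballImage m j vQ = L.tprodImages j vQ (B m vQ)) :
    C.Ind3 D := by
  constructor
  · intro m m' j vQ hv
    rw [hunit]
    exact (L.tprodImages_subset_shellPk (hUnon m m' vQ hv)).trans (hpk j vQ)
  · intro m j vQ hv
    refine ⟨?_, ?_, ?_⟩
    · rw [hunit]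
      exact (L.tprodImages_subset_shellPk (hUarc m vQ hv)).trans (hpk j vQ)
    · rw [hball]
      exact (L.tprodImages_subset_shellPk (hBarc m vQ hv)).trans (hpk j vQ)
    · intro m' hm'
      rw [hunit, hball]
      exact L.tprodImages_mono (hUB m m' hm' vQ hv)

end Column

/-! ## 3. The Dupuy–Hilado instance: honest per-place unit sets, containments from the law -/

namespace Real

open NumberField IsDedekindDomain Literature.IUT.LogVolume Literature.IUT.LogThetaLattice

variable {F : Type} [Field F] [NumberField F]

/-- The HONEST per-place unit set `O_v^×` ([IUTchIII] Prop. 3.5 (ii) (a): "the groups of units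
`(Ψ_cns(^{n,m}𝔉_≻)_{|t|})^×_v`"): at a finite place, the units of the valuation subring `O_v` (the
nonzero `x` with `x` and `x⁻¹` integral); at an archimedean place, `{‖a‖ = 1}` ([IUTchIII] Rmk. 1.2.2
(ii) "`O_k^× = {a ∈ k | |a| = 1}`"). [claim: Mochizuki2012, status: disputed] -/
def unitsSet : ∀ x : Place F, Set (Carrier x)
  | .inl _ => {a | ‖a‖ = 1}
  | .inr v => {x | x ≠ 0 ∧ x ∈ integers v ∧ x⁻¹ ∈ integers v}

/-- At a finite place the unit set lies in the integers. [folklore] -/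
theorem unitsSet_inr_subset_integers (v : HeightOneSpectrum (𝓞 F)) :
    unitsSet (.inr v : Place F) ⊆ (integers v : Set (Carrier (.inr v : Place F))) :=
  fun _ hx => hx.2.1

/-- **`O_v^× ⊆ O_v ⊆ I_v` under the law** ([IUTchIII] Rmk. 1.2.2 (i) "(b^non)"): at every finite place
the unit set lies in the log-shell. [claim: Mochizuki2012, status: disputed] -/
theorem unitsSet_subset_shell_of_law {logv : PadicLogs F} (h : LogvLaw logv)
    (v : HeightOneSpectrum (𝓞 F)) :
    unitsSet (.inr v : Place F) ⊆ shell logv (.inr v) :=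
  (unitsSet_inr_subset_integers v).trans (integers_subset_shell_of_law h v)

/-- **`O_k^× ⊆ I_k` at an archimedean place** (norm `1 ≤ π`; [IUTchIII] Rmk. 1.2.2 (ii) "(b^arc)").
[claim: Mochizuki2012, status: disputed] -/
theorem unitsSet_subset_shell_inl (logv : PadicLogs F) (w : InfinitePlace F) :
    unitsSet (.inl w : Place F) ⊆ shell logv (.inl w) := by
  rw [shell_inl]
  intro a (ha : ‖a‖ = 1)
  show ‖a‖ ≤ Real.pi
  rw [ha]
  linarith [Real.two_le_pi]

/-- The unit set lies in the shell at EVERY place (finite: under the law; archimedean: `1 ≤ π`).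
[claim: Mochizuki2012, status: disputed] -/
theorem unitsSet_subset_shell {logv : PadicLogs F} (h : LogvLaw logv) :
    ∀ x : Place F, unitsSet x ⊆ shell logv x
  | .inl w => unitsSet_subset_shell_inl logv w
  | .inr v => unitsSet_subset_shell_of_law h v

/-- **(Ind3) AT THE DUPUY–HILADO INSTANCE** (`Real.logShellsDH`, under the law `O_v ⊆ I_v`): for any
column over `logShellsDH X logv` whose images are `tprodImages` of per-place data with the UN-ITERATED
unit components pinned to the honest `Real.unitsSet` and the ball components pinned to the shells, the
(Ind3) containments of Thm. 3.11 (ii) hold — the containments of the un-iterated components are PROVED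
from the law (`unitsSet_subset_shell`); the ITERATE components' containments (`hUiterNon`: nonarch
iterates land in the shell; `hUiterArc`: arch iterates land in the ball) remain named hypotheses, whose
discharge at the analytic `p`-adic logarithm is abc-iut-L6-t3's `iterate_image_subset_logShell`
([IUTchIII] Rmk. 1.2.2 (iii)) resp. the chosen bounded arch witnesses of
`VerticallyCoricLGPArch.prop35ii_b_arcExp`. [claim: Mochizuki2012, status: disputed] -/
theorem _root_.Summit.ABC.IUTFork.Thm311.Column.ind3_of_componentwise_logShellsDH
    (X : PilotData F) (logv : PadicLogs F) (hlaw : LogvLaw logv)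
    (C : Column (logShellsDH X logv)) (D : MRData (logShellsDH X logv))
    (hpk : ∀ (j : (thetaIndex X).Label) (vQ : (thetaIndex X).VQ),
      ((logShellsDH X logv).shellPk j vQ :
        Set ((logShellsDH X logv).Packet j vQ)) ⊆ D.shellPk j vQ)
    (U : ℤ → ℕ → ∀ (vQ : (thetaIndex X).VQ), ∀ v : (thetaIndex X).Fibre vQ,
      Set ((logShellsDH X logv).carrier v.1))
    (hU0 : ∀ (m : ℤ) (vQ : (thetaIndex X).VQ) (v : (thetaIndex X).Fibre vQ),
      U m 0 vQ v = unitsSet v.1)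
    (hUiterNon : ∀ (m : ℤ) (m' : ℕ), 1 ≤ m' → ∀ (vQ : (thetaIndex X).VQ),
      (thetaIndex X).IsNon vQ → ∀ v : (thetaIndex X).Fibre vQ,
      U m m' vQ v ⊆ shell logv v.1)
    (hUiterArc : ∀ (m : ℤ) (m' : ℕ), 1 ≤ m' → ∀ (vQ : (thetaIndex X).VQ),
      ¬ (thetaIndex X).IsNon vQ → ∀ v : (thetaIndex X).Fibre vQ,
      U (m - m') m' vQ v ⊆ shell logv v.1)
    (hunit : ∀ (m : ℤ) (m' : ℕ) (j : (thetaIndex X).Label) (vQ : (thetaIndex X).VQ),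
      C.unitImage m m' j vQ = (logShellsDH X logv).tprodImages j vQ (U m m' vQ))
    (hball : ∀ (m : ℤ) (j : (thetaIndex X).Label) (vQ : (thetaIndex X).VQ),
      C.ballImage m j vQ = (logShellsDH X logv).tprodImages j vQ (fun v => shell logv v.1)) :
    C.Ind3 D := by
  refine C.ind3_of_componentwise D hpk U (fun _ vQ v => shell logv v.1) ?_ ?_ ?_ ?_ hunit hball
  · -- nonarch: every iterate's components lie in the shell subgroup
    intro m m' vQ hv v
    rcases Nat.eq_zero_or_pos m' with rfl | hm'
    · rw [hU0 m vQ v]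
      exact (unitsSet_subset_shell hlaw v.1).trans
        ((logShellsDH X logv).shell_subset_shellSubgroup v.1)
    · exact (hUiterNon m m' hm' vQ hv v).trans
        ((logShellsDH X logv).shell_subset_shellSubgroup v.1)
  · -- arch, un-iterated components
    intro m vQ _ v
    rw [hU0 m vQ v]
    exact (unitsSet_subset_shell hlaw v.1).trans
      ((logShellsDH X logv).shell_subset_shellSubgroup v.1)
  · -- arch, ball components = shells
    intro m vQ _ v
    exact (logShellsDH X logv).shell_subset_shellSubgroup v.1
  · -- arch, iterate components lie in the ball components
    intro m m' hm' vQ hv v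
    exact hUiterArc m m' hm' vQ hv v

end Real

end Thm311

end IUTFork

end Summit.ABC

end
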